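/-
Copyright: the b2b-balaban cell (near-miss cell 7), T⁴-continuum fan-out; row NE7b ROUND-2 swarm, seat
t4-ne7b-formalise-leaf-04 (gen 3) — row S6g′(a) pt 2-LV «THE LAW AT LEVELS», file 2∕2 (journal CLAIM l.9299; the
levelled twin of this lineage's `HistoryZoneMassLaw` p212899 on leaf-07 g2's levelled reading `ZoneReadingD`).
Released under the licence of the surrounding project.
-/
import Summits.QuantumFields.BalabanUV.T4Continuum.Support.HistoryZoneMassLaw
import Summits.QuantumFields.BalabanUV.T4Continuum.Support.HistoryZoneEvolveLevels

/-!
# Zone mass, the law AT LEVELS: the cardinality of a levelled tolerant zone is at most its decayed formation mass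

Summits-side support leaf of the T⁴-continuum cell (rung (B)+1 on a FINITE torus only; NOT infinite volume, NOT the
mass gap, NOT the Clay statement; NOT a proof of the spine estimate NE7b).  Row NE7b, route «COUNT», row S6g′
«MASS-BASED SIBLING COUNT» (R-OWNER-22-12 (2)), step (a) = the CARDINALITY LAW, here for leaf-07 g2's LEVELLED
tolerant reading `HistoryZones.ZoneReadingD sh n L K lv Cb c G zone` (row S6f: the cube lattice of step `t` is the
level-`lv t` blocking of the cutoff torus; window-drop steps block by `1`) — the form in which the realised pedigrees
are actually read (`HistoryZonesOrbitPedigree.birthRegionsD_genT`, `lv := levelOf (s K) K`), so that the mass road of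
row S6g′ needs no `NoDropInLife` display.  The drop-free law is `Support/HistoryZoneMassLaw.card_zone_le` (p212899);
its potential `zmass`, bookkeeping `zmass_parts`∕`length_parts_le`∕`recN_mul_le_recM` and decay transport
`mul_zmass_le` are REUSED BY NAME — the CURRENCY IS UNCHANGED (decay `θ` per TIME step, chronology in time), so the
consumers (leaf-02 g3's class-linear total `HistoryZoneMassTotal`, leaf-05 g2's `HistoryJoinsCount` majorant `M t Z`)
apply verbatim.  [folklore] structural recursion + linear real arithmetic on OUR carriers with file 1∕2
`HistoryZoneEvolveLevels` (`evolveD`, `card_evolveD_le`, `zone_subset_partsD`) and leaf-10 g2's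
`HistoryZoneMass.card_blocks_le_of_linked_real`; nothing is quoted from print, nothing printed is asserted, no
`[cite:]` tag, no `Prop`-valued fact minted; every constant SYMBOLIC in `(d, L, c, ρ, C₁)`, the stride `s` and the
level advance `m` (trigger c2∕c6).

THE LAW AT LEVELS (`card_zone_le_levels`).  For a tagged genealogy `G` (shapes `sh`), chronological, read by
`ZoneReadingD sh n L K lv Cb c G zone` with `LevelFn K lv`, with the two DISPLAYED reading fields of the drop-free law
— `hlink`: every zone of a sub-structure formed by `t ≤ K` is `ρ`-LINKED on its level torus (side
`sideD n L K lv t = n·L^{K − lv t}`), `hbirth`: a birth's zone at its step has at most `C₁·((sh b).fat + 1)` cells — a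
stride `s ≥ 1`, a LEVEL ADVANCE `m` over every `s`-window below the cutoff (`hm : u + s ≤ K → lv u + m ≤ lv (u + s)`;
`m = s∕2` is always available, `levelFn_add_half_le`, since plateaus are isolated; `m = s` on a drop-free life), the
smallness `(2·cth c 1 s + 1)^d·5^d·ρ ≤ L^m∕2` and a decay `0 ≤ θ ≤ 1` with `1∕2 ≤ θ^s`: every sub-structure `X` of `G`
formed by `t ≤ K` has `#(zone t X) ≤ zmass sh θ (2A₁C₁) (4A) t X + 2A`, `A₁ = (2·cth c 1 s + 1)^d`, `A = A₁·5^d`.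
PROOF = the proof of `card_zone_le` with `card_evolveD_le` for the pieces and, for an ANCESTOR piece evolved over the
`s`-window `[t − s, t]`, the blocking factor `L^{lv t − lv (t−s)} ≥ L^m` in `card_blocks_le_of_linked_real`
(`a = A·ρ∕L^m ≤ 1∕2 ≤ θ^s`).  §2 the packaged forms: `levelFn_two_step`, `levelFn_add_half_le`,
**`card_zone_le_levels_half`** (`m := s∕2`, no `hm`), and the drop-free specialisation **`card_zone_le_noDrop`** on
leaf-01's `ZoneReadingC` (`lv = id`, `m = s`; = p212899's statement with `cth c L s ↦ cth c 1 s`).  §3 sanity.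

HONEST: a law about OUR levelled reading; Bałaban's regions ↦ the reading stays H3; `BirthShapeNodup` NOT yet retired
on the mass road (the binding is rows S6g′-bind ∕ S6 pt 3); NE7b NOT proved; spine 0∕9.  HONEST DEPENDENCY (cell):
continuum YM on T⁴ ⇐ BetaPertH ∧ nine spine estimates (0/9 proved); BetaPertH ⇐ (D1) ∧ (D4) ∧ CAP+tail; G-an2-4
gates asym, D1 and NE2/3/4.  This file changes none of it.
-/

open Finset
open Literature.MathematicalPhysics.QuantumFieldTheory.Balaban1983to89
open T4PersistenceDictionary T4PartnerMultiplicity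
open Summit.QuantumFields.BalabanUV.T4Continuum.PlacementSkeleton
open Summit.QuantumFields.BalabanUV.T4Continuum.Crowding
open Summit.QuantumFields.BalabanUV.T4Continuum.ZoneSkeleton
open Summit.QuantumFields.BalabanUV.T4Continuum.ZoneTorus
open Summit.QuantumFields.BalabanUV.T4Continuum.HistoryZones
open Summit.QuantumFields.BalabanUV.T4Continuum.HistoryZoneMass
open Summit.QuantumFields.BalabanUV.T4Continuum.HistoryZoneEvolve
open Summit.QuantumFields.BalabanUV.T4Continuum.HistoryZoneMassLaw
open Summit.QuantumFields.BalabanUV.T4Continuum.HistoryZoneEvolveLevels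

namespace Summit.QuantumFields.BalabanUV.T4Continuum.HistoryZoneMassLawLevels

noncomputable section

variable {d : ℕ}

/-! ## §1 The law at levels -/

section Law

variable {ε : Type*} [DecidableEq ε] {sh : ε → PEv} {n L K c : ℕ} {lv : ℕ → ℕ} {Cb : ℝ} {G : Gen ε}
  {zone : ℕ → Gen ε → Finset (Fin d → ℕ)}

/-- **THE CARDINALITY LAW OF THE LEVELLED TOLERANT ZONE READING** (row S6g′(a) at levels).
Hypotheses: `L ≥ 1`; a level function `lv`; the levelled tolerant reading; chronology; the LINKED field on the level
tori (`ρ ≥ 1`); the BIRTH-CARDINALITY field (`C₁ ≥ 0`); a stride `s ≥ 1` with level advance `m` over every `s`-window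
below the cutoff and `(2·cth c 1 s + 1)^d·5^d·ρ ≤ L^m∕2`; a decay `0 ≤ θ ≤ 1` with `1∕2 ≤ θ^s`.  Conclusion, with
`A₁ := (2·cth c 1 s + 1)^d`, `A := A₁·5^d`: every sub-structure `X` of `G` formed by `t ≤ K` has
`#(zone t X) ≤ zmass sh θ (2A₁C₁) (4A) t X + 2A`. [folklore] -/
theorem card_zone_le_levels (hL : 1 ≤ L) (hlv : LevelFn K lv) (hR : ZoneReadingD sh n L K lv Cb c G zone)
    (hchr : Chrono (PEv.step ∘ sh) G) {ρ : ℕ} (hρ : 1 ≤ ρ)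
    (hlink : ∀ (t : ℕ) (X : Gen ε), Sub X G → ftime (PEv.step ∘ sh) X ≤ t → t ≤ K →
      Linked (sideD n L K lv t) ρ (zone t X))
    {C₁ : ℝ} (hC₁ : 0 ≤ C₁)
    (hbirth : ∀ (b : ε) (j : ℕ), Sub (Gen.born b j) G →
      ((zone (sh b).step (Gen.born b j)).card : ℝ) ≤ C₁ * (((sh b).fat : ℝ) + 1))
    {s m : ℕ} (hs : 1 ≤ s) (hm : ∀ u : ℕ, u + s ≤ K → lv u + m ≤ lv (u + s))
    (hsmall : (((2 * cth c 1 s + 1) ^ d : ℕ) : ℝ) * (5 : ℝ) ^ d * ρ ≤ (L : ℝ) ^ m / 2)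
    {θ : ℝ} (hθ0 : 0 ≤ θ) (hθ1 : θ ≤ 1) (hθs : 1 / 2 ≤ θ ^ s) :
    ∀ (t : ℕ) (X : Gen ε), Sub X G → ftime (PEv.step ∘ sh) X ≤ t → t ≤ K →
      ((zone t X).card : ℝ) ≤
        zmass sh θ (2 * (((2 * cth c 1 s + 1) ^ d : ℕ) : ℝ) * C₁)
            (4 * ((((2 * cth c 1 s + 1) ^ d : ℕ) : ℝ) * (5 : ℝ) ^ d)) t X +
          2 * ((((2 * cth c 1 s + 1) ^ d : ℕ) : ℝ) * (5 : ℝ) ^ d) := by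
  -- names and signs of the constants
  set A₁ : ℝ := (((2 * cth c 1 s + 1) ^ d : ℕ) : ℝ) with hA₁
  set A : ℝ := A₁ * (5 : ℝ) ^ d with hA
  set WB : ℝ := 2 * A₁ * C₁ with hWB
  set WM : ℝ := 4 * A with hWM
  have hA₁0 : 0 ≤ A₁ := by positivity
  have hA0 : 0 ≤ A := by positivity
  have hWB0 : 0 ≤ WB := by positivity
  have hWM0 : 0 ≤ WM := by positivity
  have hL0 : (0 : ℝ) < L := by exact_mod_cast hL
  have hL1 : (1 : ℝ) ≤ L := by exact_mod_cast hL
  have hLm : (0 : ℝ) < (L : ℝ) ^ m := by positivity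
  have hρ0 : (0 : ℝ) ≤ ρ := by positivity
  set a : ℝ := A * ρ / (L : ℝ) ^ m with ha
  have ha0 : 0 ≤ a := by positivity
  have hahalf : a ≤ 1 / 2 := by rw [ha, div_le_iff₀ hLm]; linarith
  have haθ : a ≤ θ ^ s := hahalf.trans hθs
  -- strong induction on `t`
  intro t
  induction t using Nat.strong_induction_on with
  | _ t ih =>
  intro X hX hft htK
  set t₀ := t + 1 - s with ht₀
  have ht₀le : t₀ ≤ t + 1 := by omega
  have hdec := zone_subset_partsD hR hchr t₀ hX ht₀le hft htK
  have hchrX := chrono_of_sub (PEv.step ∘ sh) hX hchr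
  -- the cost of one piece
  have piece : ∀ p ∈ parts sh t₀ X,
      ((evolveD n L K lv c (ustart sh t₀ p) (t - ustart sh t₀ p) (zone (ustart sh t₀ p) p)).card : ℝ) ≤
        zmass sh θ WB WM t p + (2 * a * A + A) := by
    intro p hp
    have hpX := sub_of_mem_parts t₀ hp
    have hpG : Sub p G := Sub.trans hpX hX
    have hchrp := chrono_of_sub (PEv.step ∘ sh) hpX hchrX
    have hfp : ftime (PEv.step ∘ sh) p ≤ t := (ftime_le_of_sub _ hpX hchrX).trans hft
    have hfu : ftime (PEv.step ∘ sh) p ≤ ustart sh t₀ p := le_max_right _ _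
    have hut : ustart sh t₀ p ≤ t := max_le (by omega) hfp
    have huK : ustart sh t₀ p ≤ K := hut.trans htK
    have hRu : InRange (sideD n L K lv (ustart sh t₀ p)) (zone (ustart sh t₀ p) p) := hR.inRange _ p hpG
    have hukK : ustart sh t₀ p + (t - ustart sh t₀ p) ≤ K := by rw [Nat.add_sub_cancel' hut]; exact htK
    have hcard := card_evolveD_le (c := c) hL hlv (ustart sh t₀ p) hRu hukK
    rw [Nat.add_sub_cancel' hut] at hcard
    have hks : t - ustart sh t₀ p ≤ s := by
      have : t₀ - 1 ≤ ustart sh t₀ p := le_max_left _ _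
      omega
    have hcth : (((2 * cth c 1 (t - ustart sh t₀ p) + 1) ^ d : ℕ) : ℝ) ≤ A₁ := by
      rw [hA₁]
      have hmn := cth_mono c 1 hks
      exact_mod_cast Nat.pow_le_pow_left (by omega) d
    have h1 : ((evolveD n L K lv c (ustart sh t₀ p) (t - ustart sh t₀ p) (zone (ustart sh t₀ p) p)).card : ℝ) ≤
        A₁ * ((blocks (L ^ (lv t - lv (ustart sh t₀ p))) (zone (ustart sh t₀ p) p)).card : ℝ) :=
      calc ((evolveD n L K lv c (ustart sh t₀ p) (t - ustart sh t₀ p) (zone (ustart sh t₀ p) p)).card : ℝ)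
          ≤ (((2 * cth c 1 (t - ustart sh t₀ p) + 1) ^ d : ℕ) : ℝ) *
              ((blocks (L ^ (lv t - lv (ustart sh t₀ p))) (zone (ustart sh t₀ p) p)).card : ℝ) := by
            exact_mod_cast hcard
        _ ≤ A₁ * ((blocks (L ^ (lv t - lv (ustart sh t₀ p))) (zone (ustart sh t₀ p) p)).card : ℝ) :=
            mul_le_mul_of_nonneg_right hcth (Nat.cast_nonneg _)
    have hextra : 0 ≤ 2 * a * A + A := by positivity
    rcases parts_cases t₀ hp with hold | ⟨b, j, rfl, hbt⟩
    · -- an ANCESTOR: start `u = t − s`, `s` steps, level advance `≥ m`; linked set meets few `L^{Δlv}`-blocks; the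
      -- induction hypothesis at `u`
      have hueq : ustart sh t₀ p = t - s := by
        show max (t₀ - 1) (ftime (PEv.step ∘ sh) p) = t - s
        rw [max_eq_left (by omega)]; omega
      have hkeq : t - (t - s) = s := by omega
      rw [hueq] at h1 hRu hfu huK ⊢
      rw [hkeq] at h1 ⊢
      set u := t - s with hu
      have hult : u < t := by omega
      have hus : u + s ≤ K := by omega
      have hust : u + s = t := by omega
      have ihp := ih u hult p hpG hfu huK
      have hlk := hlink u p hpG hfu huK
      have hΔ : m ≤ lv t - lv u := by have := hm u hus; rw [hust] at this; omega
      have hSe : sideD n L K lv u = sideD n L K lv t * L ^ (lv t - lv u) := by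
        have := sideD_add (n := n) (L := L) hlv hus; rwa [hust] at this
      have hRu' : InRange (sideD n L K lv t * L ^ (lv t - lv u)) (zone u p) := by rw [← hSe]; exact hRu
      have hlk' : Linked (sideD n L K lv t * L ^ (lv t - lv u)) ρ (zone u p) := by rw [← hSe]; exact hlk
      have hbl := card_blocks_le_of_linked_real (Nat.one_le_pow _ _ hL) hρ hRu' hlk'
      have hz0 : (0 : ℝ) ≤ (ρ : ℝ) * ((zone u p).card : ℝ) := by positivity
      have hpow : (L : ℝ) ^ m ≤ (L : ℝ) ^ (lv t - lv u) := pow_le_pow_right₀ hL1 hΔ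
      have hdiv : (ρ : ℝ) * ((zone u p).card : ℝ) / (L : ℝ) ^ (lv t - lv u) ≤
          (ρ : ℝ) * ((zone u p).card : ℝ) / (L : ℝ) ^ m := div_le_div_of_nonneg_left hz0 hLm hpow
      have hbl' : ((blocks (L ^ (lv t - lv u)) (zone u p)).card : ℝ) ≤
          (5 : ℝ) ^ d * ((ρ : ℝ) * ((zone u p).card : ℝ) / (L : ℝ) ^ m + 1) := by
        have h := hbl
        push_cast at h
        exact h.trans (mul_le_mul_of_nonneg_left (by linarith) (by positivity))
      have h2 : A₁ * ((blocks (L ^ (lv t - lv u)) (zone u p)).card : ℝ) ≤ a * ((zone u p).card : ℝ) + A := by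
        have h := mul_le_mul_of_nonneg_left hbl' hA₁0
        have e : A₁ * ((5 : ℝ) ^ d * ((ρ : ℝ) * ((zone u p).card : ℝ) / (L : ℝ) ^ m + 1)) =
            a * ((zone u p).card : ℝ) + A := by
          rw [ha, hA]; ring
        linarith
      have h3 : a * ((zone u p).card : ℝ) ≤ a * (zmass sh θ WB WM u p + 2 * A) := mul_le_mul_of_nonneg_left ihp ha0
      have h4 : a * zmass sh θ WB WM u p ≤ zmass sh θ WB WM t p := by
        have h := mul_zmass_le (sh := sh) hθ0 hWB0 hWM0 ha0 haθ hchrp hfu (k := s)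
        rwa [hust] at h
      linarith
    · -- a RECENT BIRTH: start `u = st b`, age `≤ s − 1`; `#blocks ≤ #zone (st b) ≤ C₁·(fat+1)`
      have hueq : ustart sh t₀ (Gen.born b j) = (sh b).step := by
        show max (t₀ - 1) (sh b).step = (sh b).step
        exact max_eq_right (by omega)
      rw [hueq] at h1 ⊢
      set k := t - (sh b).step with hk
      have hks' : k ≤ s - 1 := by omega
      have hbl : ((blocks (L ^ (lv t - lv (sh b).step)) (zone (sh b).step (Gen.born b j))).card : ℝ) ≤
          C₁ * (((sh b).fat : ℝ) + 1) :=
        le_trans (by exact_mod_cast card_image_le) (hbirth b j hpG)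
      have h2 : ((evolveD n L K lv c (sh b).step k (zone (sh b).step (Gen.born b j))).card : ℝ) ≤
          A₁ * (C₁ * (((sh b).fat : ℝ) + 1)) := h1.trans (mul_le_mul_of_nonneg_left hbl hA₁0)
      have hpow : 1 / 2 ≤ θ ^ k := hθs.trans (pow_le_pow_of_le_one hθ0 hθ1 (by omega))
      have hz : zmass sh θ WB WM t (Gen.born b j) = WB * (((sh b).fat : ℝ) + 1) * θ ^ k := rfl
      rw [hz, hWB]
      have hf0 : 0 ≤ A₁ * (C₁ * (((sh b).fat : ℝ) + 1)) := by positivity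
      have hcore : A₁ * (C₁ * (((sh b).fat : ℝ) + 1)) ≤ 2 * A₁ * C₁ * (((sh b).fat : ℝ) + 1) * θ ^ k := by
        nlinarith [mul_le_mul_of_nonneg_left hpow hf0]
      linarith
  -- summing the pieces
  have hsum : ((zone t X).card : ℝ) ≤
      ((parts sh t₀ X).map fun p => zmass sh θ WB WM t p + (2 * a * A + A)).sum := by
    refine (le_trans (by exact_mod_cast card_le_card hdec) (card_lunion_le _)).trans ?_
    rw [List.map_map]
    exact sum_map_le_sum_map fun p hp => piece p hp
  rw [List.sum_map_add, sum_map_const] at hsum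
  -- bookkeeping: pieces + recent mergers = whole; the piece count; the recent mergers' floor
  have hbook := zmass_parts (sh := sh) (θ := θ) (WB := WB) (WM := WM) t₀ t X
  have hlen : ((parts sh t₀ X).length : ℝ) ≤ (recN sh t₀ X : ℝ) + 1 := by exact_mod_cast length_parts_le t₀ X
  have hrec := recN_mul_le_recM (sh := sh) hθ0 hθ1 hWM0 (t₀ := t₀) (t := t) (s := s) (by omega) hchrX hft
  have hpow : 1 / 2 ≤ θ ^ (s - 1) := hθs.trans (pow_le_pow_of_le_one hθ0 hθ1 (Nat.sub_le s 1))
  have hunit : 2 * a * A + A ≤ 2 * A := by nlinarith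
  have hunit' : 2 * a * A + A ≤ WM * θ ^ (s - 1) := by
    rw [hWM]; nlinarith [mul_le_mul_of_nonneg_left hpow hA0]
  have hN0 : (0 : ℝ) ≤ recN sh t₀ X := Nat.cast_nonneg _
  have hfinal : ((parts sh t₀ X).length : ℝ) * (2 * a * A + A) ≤ recM sh θ WM t₀ t X + 2 * A := by
    have h1 : ((parts sh t₀ X).length : ℝ) * (2 * a * A + A) ≤ ((recN sh t₀ X : ℝ) + 1) * (2 * a * A + A) :=
      mul_le_mul_of_nonneg_right hlen (by positivity)
    have h2 : (recN sh t₀ X : ℝ) * (2 * a * A + A) ≤ (recN sh t₀ X : ℝ) * (WM * θ ^ (s - 1)) :=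
      mul_le_mul_of_nonneg_left hunit' hN0
    linarith
  linarith

end Law

/-! ## §2 Packaged forms: the half-stride level advance, and the drop-free specialisation -/

section Packaged

/-- **TWO STEPS RISE AT LEAST ONE LEVEL** (plateaus are isolated). [folklore] -/
theorem levelFn_two_step {K : ℕ} {lv : ℕ → ℕ} (hlv : LevelFn K lv) (t : ℕ) : lv t + 1 ≤ lv (t + 2) := by
  have h2 : lv (t + 1) ≤ lv (t + 2) := hlv.mono (t + 1)
  rcases hlv.succ_eq_or t with h | h
  · have := hlv.isolated t h; omega
  · omega

/-- **AN `s`-WINDOW RISES AT LEAST `s∕2` LEVELS**: `lv u + s∕2 ≤ lv (u + s)` for a level function. [folklore] -/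
theorem levelFn_add_half_le {K : ℕ} {lv : ℕ → ℕ} (hlv : LevelFn K lv) (u s : ℕ) : lv u + s / 2 ≤ lv (u + s) := by
  have key : ∀ k : ℕ, lv u + k ≤ lv (u + 2 * k) := by
    intro k
    induction k with
    | zero => simp
    | succ k ih =>
        have h := levelFn_two_step hlv (u + 2 * k)
        rw [show u + 2 * (k + 1) = u + 2 * k + 2 by ring]
        omega
  have h1 := key (s / 2)
  have h2 : lv (u + 2 * (s / 2)) ≤ lv (u + s) := hlv.monotone (by omega)
  omega

variable {ε : Type*} [DecidableEq ε] {sh : ε → PEv} {n L K c : ℕ} {lv : ℕ → ℕ} {Cb : ℝ} {G : Gen ε}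
  {zone : ℕ → Gen ε → Finset (Fin d → ℕ)}

/-- **THE LAW AT LEVELS WITH THE HALF-STRIDE ADVANCE** (`m := s∕2`, always available): smallness
`(2·cth c 1 s + 1)^d·5^d·ρ ≤ L^{s∕2}∕2`, no level-advance binder. [folklore] -/
theorem card_zone_le_levels_half (hL : 1 ≤ L) (hlv : LevelFn K lv) (hR : ZoneReadingD sh n L K lv Cb c G zone)
    (hchr : Chrono (PEv.step ∘ sh) G) {ρ : ℕ} (hρ : 1 ≤ ρ)
    (hlink : ∀ (t : ℕ) (X : Gen ε), Sub X G → ftime (PEv.step ∘ sh) X ≤ t → t ≤ K →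
      Linked (sideD n L K lv t) ρ (zone t X))
    {C₁ : ℝ} (hC₁ : 0 ≤ C₁)
    (hbirth : ∀ (b : ε) (j : ℕ), Sub (Gen.born b j) G →
      ((zone (sh b).step (Gen.born b j)).card : ℝ) ≤ C₁ * (((sh b).fat : ℝ) + 1))
    {s : ℕ} (hs : 1 ≤ s)
    (hsmall : (((2 * cth c 1 s + 1) ^ d : ℕ) : ℝ) * (5 : ℝ) ^ d * ρ ≤ (L : ℝ) ^ (s / 2) / 2)
    {θ : ℝ} (hθ0 : 0 ≤ θ) (hθ1 : θ ≤ 1) (hθs : 1 / 2 ≤ θ ^ s) :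
    ∀ (t : ℕ) (X : Gen ε), Sub X G → ftime (PEv.step ∘ sh) X ≤ t → t ≤ K →
      ((zone t X).card : ℝ) ≤
        zmass sh θ (2 * (((2 * cth c 1 s + 1) ^ d : ℕ) : ℝ) * C₁)
            (4 * ((((2 * cth c 1 s + 1) ^ d : ℕ) : ℝ) * (5 : ℝ) ^ d)) t X +
          2 * ((((2 * cth c 1 s + 1) ^ d : ℕ) : ℝ) * (5 : ℝ) ^ d) :=
  card_zone_le_levels hL hlv hR hchr hρ hlink hC₁ hbirth hs (fun u _ => levelFn_add_half_le hlv u s) hsmall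
    hθ0 hθ1 hθs

/-- **THE DROP-FREE SPECIALISATION**: on leaf-01's tolerant reading `ZoneReadingC` (`lv = id`, level advance `m = s`)
the law at levels is `HistoryZoneMassLaw.card_zone_le` with the level-pattern-free radius `cth c 1 s` in place of
`cth c L s`. [folklore] -/
theorem card_zone_le_noDrop (hL : 1 ≤ L) (hR : ZoneReadingC sh n L K Cb c G zone) (hchr : Chrono (PEv.step ∘ sh) G)
    {ρ : ℕ} (hρ : 1 ≤ ρ)
    (hlink : ∀ (t : ℕ) (X : Gen ε), Sub X G → ftime (PEv.step ∘ sh) X ≤ t → t ≤ K →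
      Linked (side n L K t) ρ (zone t X))
    {C₁ : ℝ} (hC₁ : 0 ≤ C₁)
    (hbirth : ∀ (b : ε) (j : ℕ), Sub (Gen.born b j) G →
      ((zone (sh b).step (Gen.born b j)).card : ℝ) ≤ C₁ * (((sh b).fat : ℝ) + 1))
    {s : ℕ} (hs : 1 ≤ s)
    (hsmall : (((2 * cth c 1 s + 1) ^ d : ℕ) : ℝ) * (5 : ℝ) ^ d * ρ ≤ (L : ℝ) ^ s / 2)
    {θ : ℝ} (hθ0 : 0 ≤ θ) (hθ1 : θ ≤ 1) (hθs : 1 / 2 ≤ θ ^ s) :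
    ∀ (t : ℕ) (X : Gen ε), Sub X G → ftime (PEv.step ∘ sh) X ≤ t → t ≤ K →
      ((zone t X).card : ℝ) ≤
        zmass sh θ (2 * (((2 * cth c 1 s + 1) ^ d : ℕ) : ℝ) * C₁)
            (4 * ((((2 * cth c 1 s + 1) ^ d : ℕ) : ℝ) * (5 : ℝ) ^ d)) t X +
          2 * ((((2 * cth c 1 s + 1) ^ d : ℕ) : ℝ) * (5 : ℝ) ^ d) :=
  card_zone_le_levels hL (levelFn_id K) (zoneReadingD_of_readingC sh hR) hchr hρ
    (fun t X hX hft htK => hlink t X hX hft htK) hC₁ hbirth hs (fun _ _ => le_rfl) hsmall hθ0 hθ1 hθs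

end Packaged

/-! ## §3 Sanity (decided ∕ closed instances) -/

namespace Sanity

/-- a level function with ONE plateau (`0, 1, 1, 2, 3, …`: the step `1 → 2` is a window drop) rises by `1 ≥ 2∕2` over
the window `[1, 3]` and by `2 ≥ 3∕2` over `[0, 3]` — the half-stride advance of `levelFn_add_half_le`, decided on the
values -/
example : (fun t : ℕ => if t ≤ 1 then t else t - 1) 1 + 2 / 2 ≤ (fun t : ℕ => if t ≤ 1 then t else t - 1) (1 + 2) ∧
    (fun t : ℕ => if t ≤ 1 then t else t - 1) 0 + 3 / 2 ≤ (fun t : ℕ => if t ≤ 1 then t else t - 1) (0 + 3) := by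
  decide

/-- the smallness at levels for `d = 1`, `c = 0`, `s = 4` (radius `cth 0 1 4 = 4`, `A₁ = 9`), `ρ = 1`, `L = 100`,
`m = s∕2 = 2`: `9·5·1 = 45 ≤ 100²∕2` (closed arithmetic) -/
example : (((2 * cth 0 1 4 + 1) ^ 1 : ℕ) : ℝ) * (5 : ℝ) ^ 1 * (1 : ℕ) ≤ (100 : ℝ) ^ (4 / 2) / 2 := by
  norm_num [cth]

end Sanity

end

end Summit.QuantumFields.BalabanUV.T4Continuum.HistoryZoneMassLawLevels
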